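import Summits.QuantumFields.YangMills.Theorems.BalabanUVNodesN12MinimiserFamilyAtRecordBjTowerThresholdUniform
import Summits.QuantumFields.YangMills.Theorems.BalabanUVNodesN12MinimiserFamilyAtRecordBjTowerDatumLettersUniform
import Literature.MathematicalPhysics.QuantumFieldTheory.Balaban1983to89.B15ShellGauge193Local
import Literature.MathematicalPhysics.QuantumFieldTheory.Balaban1983to89.B15Prop1Carrier
import HarnessLib

/-!
# BalabanUVNodes ∕ N12 — THE (J0′) JUNCTION BY NAME, εreg-UNIFORM EDITION OF RECORD: the knit's displayed `hMin` ROW SHAPE (12Q ∕ 12X-W «DIRECT v11», p703802 ∕ p704012) with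
# `∃ δ₀ > 0` FIRST and `∃ R > 0` after the window, the guard radius, the class tolerance and the gauge tolerance — FROM (E) + (δ) + (T1@q₀) PER BASE FIELD, (δ) plain or for a RESIDUAL
# re-gauging of the minimiser
# ([Balaban1989LargeFieldI] (1.74) p.192, p.193 ll.14–20, Prop. 1 p.194; [Balaban1985Variational] (2)–(4),(7) p.278, Thm 1 p.279, Sect. C (44)–(48) p.285, (81)–(83) p.290, Sect. G
# pp.305–307, (181) p.307, Prop. 9 (190) p.309; [Balaban1985RegularSpaces] (1.7), (1.9) p.77; [Balaban1989LargeFieldII] p.357, (1.7)–(1.9) p.358, (1.12)–(1.13) p.359;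
# [Balaban1988Convergent] (2.2) p.255, (2.10)–(2.13) pp.256–257; [Balaban1985Averaging] Prop. 2 (52)–(54) p.26, (122)–(126) p.36; [Balaban1987RG1] (0.4) p.253)

Cell `pub-ymgap` (HUMAN RULINGS D-0062 ∕ D-0149), seat `pub-ymgap-dag-n12-d` g24 (R134 N12 [B15] s2 = by-name knit at the record; census item E1 = the (J0′) row; count-neutral helper of K1⁹
`stmt-QuantumFields-27364`, `--kind proof --supports … --as helper`).  THEOREMS ONLY (0 `def`, 0 `instance`, 0 `sorry`); compositions BY NAME.  Fourth leaf of the junction family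
`N12MinimiserFamilyKnitRow` (p707982) ∕ `…KnitRowTower` (p711030 + p721314) ∕ `…KnitRowThreshold` (this seat g24, over V4) — own leaf for the 400-line rule; same recipe.

WHAT.  THIS FILE junctions the knit pair's displayed (J0′) row (binders `R 𝓐₀` + the ∀-body `hMin`) to this seat's εreg-uniform twin of record
`N12MinimiserFamilyAtRecordBjTowerThresholdUniform.hMin_closedGuard_atRecord_Bj_of_printLetters_ofClassThresholdUniform(_residual)` — the w1 lineage's chart theorem at `𝐁_k(Z)` over
the LANE's U2 `N12MinimiserFamilyOfClassThresholdUniform` (dag-n12-c g26, p724662: every analytic letter inside, `δ₀` announced from (instance, height, forest) data FIRST) — and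
DISCHARGES the datum-regularity row from the knit's OWN geometry rows exactly as the siblings: a base field of the closed guard `|V_k(∂p′) − 1| ≤ eR` on `(Z ∩ Λᶜ)^{(k)}` has a p. 193
extension `Ṽ_k = ext V_k` that is `12d(n+2)²·2eR`-regular on `Z^{(k)}` (`B15ShellGauge193Local.dist1_plaqHol_extend_shellGauge_le`, [IV] p. 193 ll. 14–16), hence `2(cE+1)eR`-regular
for the knit's extension constant `cE ≥ 12d(n+2)²` (12Q v11's `hcE`).  RESULT (E1, knit side, εreg-uniform edition of record): per (instance, height) the existence letters `ρ″`∕`hHB` and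
ONE threshold `δ₀`; then for every window and its geometry rows, every guard radius `eR > 0` with the budget `6(d−1)Lᵏ·2(cE+1)eR ≤ ρ″`, every class tolerance `εr > 0` below the floors
and every gauge tolerance `δc ≤ δ₀`, the knit's `hMin P i` row holds under `∃ R > 0` as a theorem BY NAME of EXACTLY (E)@`εr` + (δ)@`δc` + (T1@q₀) per base field of the closed guard
(§1), resp. (E) + (σ residual, (δ)@`δc` for `U₀^σ`) + (T1@q₀) (§2 — dag-n12-w3's (σ)_N output shape: the road of record).

WHY NOT INSIDE THE KNIT (LOCATED-E1-KNIT): displaying these rows INSTEAD of `R 𝓐₀ hMin` in 12Q∕12X-W would bind the implicit-function radius existentially before the threshold∕floor rows —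
vacuous by shape; the junction lives consumer-side: `obtain ⟨δ₀, hδ₀, h⟩ := exists_R_hMinRow_of_printLetters_ofClassThresholdUniform_residual …` ONCE per (instance, height), then per
window ∕ tolerance `obtain ⟨R, hR, hMin⟩ := h Λ lo hi eR … εr … (δc := …) … (per-base-field rows)` feeds the knit at `R P i := R`.

HONEST FRAMING ∕ LOCATED.  Two compositions by name + 8 lines of arithmetic each; (E)∕(δ)∕(T1@q₀) DISPLAYED ([15] Thm 1 existence — NODE 00 ∕ b11; a gauge letter — the direct road's
(N)∕(σ)_N producers, LOCATED-GEOM v3; [15] Thm 1 uniqueness — N07 ∕ b11) — NOT discharged here; `δ₀`, `R`, `ρ″`, `εH`, `B` = EXISTENCE constants per (instance, height) (census U4 at the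
shape level repaired by U2; print's volume-uniform (46)∕(83) and `k`-uniformity NOT claimed); nothing of Bałaban's estimates asserted; N12 NOT discharged; K1⁹ NOT closed; counts unmoved;
one finite 𝕋⁴ programme at fixed `ε = L^{-K}` — R4 closes only the conditional rung `BalabanLadder.UV`; no summit statement is proved here and NOT the Yang–Mills mass gap (Clay);
nothing continuum ∕ ℝ⁴ ∕ OS.
-/

noncomputable section

namespace Summit.QuantumFields.YangMills.BalabanUVNodes.N12MinimiserFamilyKnitRowThresholdUniform

open scoped BigOperators Matrix.Norms.L2Operator Topology
open Literature.MathematicalPhysics.QuantumFieldTheory.Balaban1983to89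
open T4Continuum
open B15DeterminingSets GaugeField
open ExpMeanLog (expMeanLogSU deltaSU)
open T4AdjointCovarianceUnitary (lieSU)
open Node00
open B15SU2ChartHolomorphic (genE)
open B15Prop1AnalyticExtClause (cplxVec)
open B15Prop1ChartCalculusSU2 (E3)
open T4CubeChartGnomonic (SU2)
open B14.Eq213DetSet (Bj maxDomT Bj_of_gt)
open B14.Eq213MaximalDomains (side)
open B14.Eq22Determines (IsBlockUnion)
open B14.Eq216Concrete (feeds)
open B5Eq118OneStroke (iterBlockOf)
open B15Eq112TorusCover (lift)
open T4AxialGaugeSmallField (boxPlaqs castSite)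
open Summit.QuantumFields.YangMills.BalabanUVNodes.N12MinimiserFamilyAtRecordBjTowerThresholdUniform (hMin_closedGuard_atRecord_Bj_of_printLetters_ofClassThresholdUniform
  hMin_closedGuard_atRecord_Bj_of_printLetters_ofClassThresholdUniform_residual)
open Literature.MathematicalPhysics.QuantumFieldTheory.BalabanImbrieJaffe1984to88.BIJ85Eq453GaugeField (qsstarGIter0)
open B15AveragingHolomorphic (iterMh)
open B15SU2ChartHolomorphic (expMulC logCoordC)
open B15ShellGauge193 (shellGauge)
open B15Extension193 (extend)
open B16Sect1Backgrounds (toMS expMul)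
open B15Prop1ChartSU2 (su2Chart)
open Metric (ball)
open B15Prop1Carrier (plaqsInside)
open B15Prop1ClosedGuardUniformRadius (plaqLeOn_of_plaqSmallOn)
open B15ShellGauge193Local (dist1_plaqHol_extend_shellGauge_le)
open Summit.QuantumFields.YangMills.BalabanUVNodes.N12MinimiserFamilyAtRecordBjTowerDatumLettersUniform (hMin_closedGuard_atRecord_Bj_of_printLetters_ofClassDatumLettersUniform)

variable {F : T4Family} {k : ℕ}



/-! ## §1  The knit's (J0′) row from (E)@`εr` + (δ)@`δc` + (T1@q₀) per base field of the closed guard — `δ₀` first, then window ∕ guard radius ∕ class tolerance ∕ gauge tolerance -/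

/-- ★★★ **THE KNIT's (J0′) ROW SHAPE, εreg-UNIFORM: ONE ANNOUNCED `δ₀ > 0` PER (INSTANCE, HEIGHT), THEN FOR EVERY WINDOW, GUARD RADIUS, CLASS TOLERANCE AND GAUGE TOLERANCE, UNDER
`∃ R > 0`, FROM (E) + (δ) + (T1@q₀) PER BASE FIELD** — over `N12MinimiserFamilyAtRecordBjTowerThresholdUniform.hMin_closedGuard_atRecord_Bj_of_printLetters_ofClassThresholdUniform` at
`G := plaqsInside (pts k (Z ∩ Λᶜ))`, with the datum's scale-`k` regularity row DISCHARGED at `δ := 2(cE+1)·eR` from the closed guard on `(Z ∩ Λᶜ)^{(k)}` and the p. 193 extension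
(`dist1_plaqHol_extend_shellGauge_le`) through the knit's own geometry rows (`hn`, `hN3`, `hlohi`, `hbox`, `hZ`, `hcE`, `3 ≤ d`), now quantified AFTER `δ₀` together with `eR > 0`, the
budget `6(d−1)Lᵏ·2(cE+1)eR ≤ ρ″`, the extension, `𝓐₀`, the class tolerance `εr > 0` (floors, `hα3`∕`hα2`) and `0 ≤ δc ≤ δ₀`; per base field of the closed guard: (E) the (2.12) minimiser
`U₀` for `U_k({Ω_j(Z)}, εr)`, (δ) `U₀` bondwise `δc`-flat on the plaquettes meeting a bond sourced in `Ω₁(Z)`, (T1@q₀) over the closure of the class.  Conclusion: 12Q ∕ 12X-W v11's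
`hMin P i` ∀-body on the strict guard (class at `εr`).
[cite: Balaban1989LargeFieldI, (1.74) p.192, p.193 L14–20, Prop. 1 p.194; Balaban1985Variational, (2),(7) p.278, Thm 1 p.279, Sect. C (44)–(48) p.285, (81)–(83) p.290, Sect. G pp.305–307, Prop. 9 (190) p.309; Balaban1985RegularSpaces, (1.7), (1.9) p.77; Balaban1989LargeFieldII, p.357, (1.7)–(1.9) p.358, (1.12)–(1.13) p.359; Balaban1988Convergent, (2.2) p.255, (2.10)–(2.13) pp.256–257; Balaban1985Averaging, Prop. 2 (52)–(54) p.26, (122)–(126) p.36; Balaban1987RG1, (0.4) p.253] -/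
theorem exists_R_hMinRow_of_printLetters_ofClassThresholdUniform (ν : Node00.Stage7Numerics) (Kt : ℕ) (hd3 : 3 ≤ (F.P Kt).d) (Z : Set (Site (F.P Kt) 0))
    (hkK : k + 1 ≤ (F.P Kt).m + (F.P Kt).K) (hk1 : 1 ≤ k) (hdiv : side (F.P Kt).L ν.M₁ k ∣ (F.P Kt).sitesPerDir 0) (hfloor : ((F.P Kt).d + 14) * (F.P Kt).L ≤ ν.M₁) (hZblk : IsBlockUnion k Z)
    -- the per-HEIGHT letters (EXISTENCE constants per (instance, height), inhabited before everything else by dag-n12-w6's `N12HsurjOfClass.exists_hsurjLetters`): the radius letter `hsbU` at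
    -- `ρ″ > 0` and the right-inverse letter `hHB` at `(εH, B)`, `0 ≤ B` — `ν.εreg` is NOT read (the class tolerance `εr` comes after the threshold)
    {ρ'' : ℝ} (hsbU : ∀ W : GaugeField (F.P Kt) 0 SU2, ‖coeField W - 1‖ ≤ ρ'' → SmallBelow (Node00.avOfRecord F 2 Kt) k W) (hρ : 0 < ρ'')
    {εH B : ℝ}
    (hHB : ∀ (Wd : MSField (F.P Kt) SU2) (U₀ : GaugeField (F.P Kt) 0 SU2),
      AgreeOn (Bj ν.M₁ Z k) (avgFamily (avOfRecord F 2 Kt) U₀) Wd →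
      (∀ i' : Fin (constrCard (Bj ν.M₁ Z k) k), ∃ U' : GaugeField (F.P Kt) 0 SU2,
        (∀ b ∈ feeds (((constrEnum (Bj ν.M₁ Z k) k).symm i').1 : ℕ) ((constrEnum (Bj ν.M₁ Z k) k).symm i').2.1, U' b = U₀ b) ∧
          SmallBelow (avOfRecord F 2 Kt) k U') →
      (∀ (j : ℕ), 1 ≤ j → j ≤ k → ∀ y : Site (F.P Kt) j, embIter j y ∈ maxDomT ν.M₁ Z j → ∃ U' : GaugeField (F.P Kt) 0 SU2,
        (∀ c : PBond (F.P Kt) j, (c.src = y ∨ c.tgt = y) → ∀ b₀ : PBond (F.P Kt) 0,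
          (iterBlockOf j b₀.src = c.src ∨ iterBlockOf j b₀.src = c.tgt) → (iterBlockOf j b₀.tgt = c.src ∨ iterBlockOf j b₀.tgt = c.tgt) → U' b₀ = U₀ b₀) ∧
        SmallBelow (avOfRecord F 2 Kt) k U') →
      (∀ (j : ℕ), 1 ≤ j → j ≤ k → ∀ y : Site (F.P Kt) j, embIter j y ∈ maxDomT ν.M₁ Z j →
        PlaqSmallOn (boxPlaqs (fun κ => lift (F.P Kt) (embIter j y) κ - ((((F.P Kt).L ^ j : ℕ) : ℤ) + ((((F.P Kt).L ^ j - 1) / 2 : ℕ) : ℤ)))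
          (fun κ => lift (F.P Kt) (embIter j y) κ + ((((F.P Kt).L ^ j : ℕ) : ℤ) + ((((F.P Kt).L ^ j - 1) / 2 : ℕ) : ℤ))) : Set (Plaq (F.P Kt) 0)) εH U₀) →
      ∃ H : (Fin (constrCard (Bj ν.M₁ Z k) k) → lieSU (Fin 2)) → PBond (F.P Kt) 0 → lieSU (Fin 2),
        (∀ v, fderiv ℝ (msChart F 2 Kt k (Bj ν.M₁ Z k) Wd U₀) 0 (H v) = v) ∧ ∀ v, Real.sqrt (∑ b, ‖H v b‖ ^ 2) ≤ B * ‖v‖) (hB0 : 0 ≤ B) :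
    ∃ δ₀ : ℝ, 0 < δ₀ ∧
    -- AFTER THE THRESHOLD: the knit's window `Λ lo hi`, the guard radius `eR > 0`, the knit's own GEOMETRY rows `hn hN3 hlohi hbox hZ` and extension constant `cE ≥ 12d(n+2)²` (12Q v11's
    -- `hcE`) — from which the datum's scale-`k` plaquette regularity on `Z` at `δ := 2(cE+1)·eR` follows (`dist1_plaqHol_extend_shellGauge_le`) — the budget `6(d−1)Lᵏ·δ ≤ ρ″`, the p. 193
    -- extension at `pts k Λ`, the bound `𝓐₀`
    ∀ (Λ : Set (Site (F.P Kt) 0)) (lo hi : Fin (F.P Kt).d → ℤ) (eR : ℝ), 0 < eR →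
    ∀ (n : ℕ), (∀ κ, hi κ ≤ lo κ + n) → (∀ κ, hi κ - lo κ + 3 < ((F.P Kt).sitesPerDir k : ℤ)) → lo ≤ hi →
      pts k Λ = (castSite '' Set.Icc lo hi : Set (Site (F.P Kt) k)) → (boxPlaqs (lo - 1) (hi + 1) : Set (Plaq (F.P Kt) k)) ⊆ plaqsInside (pts k Z) →
    ∀ {cE : ℝ}, 12 * ((F.P Kt).d : ℝ) * ((n : ℝ) + 2) ^ 2 ≤ cE → 6 * ((((F.P Kt).d - 1 : ℕ)) : ℝ) * (F.P Kt).L ^ k * (2 * ((cE + 1) * eR)) ≤ ρ'' →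
    ∀ (ext : GaugeField (F.P Kt) k SU2 → GaugeField (F.P Kt) k SU2), (∀ W, ext W = extend (pts k Λ) (shellGauge W lo hi) W) →
    ∀ {𝓐₀ : ℝ}, 1 < 𝓐₀ →
    -- (w1 g4's class letters at the tolerance `εr`: positivity and [4] Prop. 2's smallness at `α₀ = 2L²·εr` — the inputs of `classLetters_closure_regMSCoPOfRecord_Bj`, which discharges U2's
    -- class facts `reg' hreg' hcl hDreg'` at `reg' := closure` of the class `U_k({Ω_j(Z)}, εr)`)
    ∀ (εr : ℝ), 0 < εr → 12 * ((((F.P Kt).d - 1 : ℕ)) : ℝ) * (F.P Kt).L * εr ≤ ρ'' → εr ≤ εH →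
      (143 * (((((F.P Kt).d + 4 : ℕ) : ℝ)) ^ 2 / 4) ^ 2) * (2 * ((F.P Kt).L : ℝ) ^ 2 * εr) ≤ 1 / 3 →
      2 * (2 * ((F.P Kt).L : ℝ) ^ 2 * εr) ≤ 2 * deltaSU (Fin 2) / ((((F.P Kt).d + 4) * (F.P Kt).L : ℕ) : ℝ) ^ 2 →
    ∀ {δc : ℝ}, 0 ≤ δc → δc ≤ δ₀ →
    (∀ Vk : GaugeField (F.P Kt) k SU2, (∀ p ∈ plaqsInside (pts k (Z ∩ Λᶜ)), dist1 (GaugeField.plaqHol Vk p) ≤ eR) → ∃ U₀ : GaugeField (F.P Kt) 0 SU2,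
      IsMinimizer (Node00.avOfRecord F 2 Kt) (Node00.regMSCoPOfRecord F 2 {ν with εreg := εr} Kt k (maxDomT ν.M₁ Z)) (Bj ν.M₁ Z k)
        (avgFamily (Node00.avOfRecord F 2 Kt) (qsstarGIter0 k (ext Vk))) U₀ ∧
      -- (NO datum plaquette-regularity row: discharged below from the closed guard on `Z ∩ Λᶜ` and the p. 193 extension)
      -- (δ) DISPLAYED — THE ONE GAUGE letter (the direct road's (N)-package clause): `U₀` bondwise `δc`-flat on the plaquettes meeting a bond sourced in `Ω₁(Z)`; the tower-flatness row (δ_T) and the multiplier row (M) of p717767 FOLLOW (`B15Prop1TowerFlatOfNearFlat`; dag-n12-w6's `…N12MultiplierLetterOfClass` + the lane's `…N12SliceDatumCurvatureOfClass`)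
      (∀ q : Plaq (F.P Kt) 0, ((⟨q.src, q.μ⟩ : PBond (F.P Kt) 0) ∈ {b : PBond (F.P Kt) 0 | b.src ∈ maxDomT ν.M₁ Z 1} ∨
          (⟨q.src.shift q.μ, q.ν⟩ : PBond (F.P Kt) 0) ∈ {b : PBond (F.P Kt) 0 | b.src ∈ maxDomT ν.M₁ Z 1} ∨
          (⟨q.src.shift q.ν, q.μ⟩ : PBond (F.P Kt) 0) ∈ {b : PBond (F.P Kt) 0 | b.src ∈ maxDomT ν.M₁ Z 1} ∨
          (⟨q.src, q.ν⟩ : PBond (F.P Kt) 0) ∈ {b : PBond (F.P Kt) 0 | b.src ∈ maxDomT ν.M₁ Z 1}) →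
        ‖((U₀ ⟨q.src, q.μ⟩ : SU2) : Matrix (Fin 2) (Fin 2) ℂ) - 1‖ ≤ δc ∧ ‖((U₀ ⟨q.src.shift q.μ, q.ν⟩ : SU2) : Matrix (Fin 2) (Fin 2) ℂ) - 1‖ ≤ δc ∧
          ‖((U₀ ⟨q.src.shift q.ν, q.μ⟩ : SU2) : Matrix (Fin 2) (Fin 2) ℂ) - 1‖ ≤ δc ∧ ‖((U₀ ⟨q.src, q.ν⟩ : SU2) : Matrix (Fin 2) (Fin 2) ℂ) - 1‖ ≤ δc) ∧
      -- (T1@q₀) — the capstone's row verbatim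
      (∀ U ∈ closure (Node00.regMSCoPOfRecord F 2 {ν with εreg := εr} Kt k (maxDomT ν.M₁ Z)),
        AgreeOn (Bj ν.M₁ Z k) (avgFamily (Node00.avOfRecord F 2 Kt) U) (avgFamily (Node00.avOfRecord F 2 Kt) (qsstarGIter0 k (ext Vk))) →
        wilsonAction4 U ≤ wilsonAction4 U₀ →
          ∃ u : GaugeTransf (F.P Kt) 0 SU2, (∀ j, j ≤ k → ∀ b ∈ bondsOf (Bj ν.M₁ Z k j), toMS u j b.src = toMS u j b.tgt ∧ ∀ g : SU2, toMS u j b.src * g = g * toMS u j b.src) ∧ gaugeAct u U = U₀)) →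
    ∃ R : ℝ, 0 < R ∧ ∀ Vk : GaugeField (F.P Kt) k SU2, PlaqSmallOn (plaqsInside (pts k (Z ∩ Λᶜ))) eR Vk →
      ∃ Ũ : VecField (F.P Kt) k (EuclideanSpace ℂ (Fin 3)) × VecField (F.P Kt) k (EuclideanSpace ℂ (Fin 3)) → PBond (F.P Kt) 0 → Matrix (Fin 2) (Fin 2) ℂ,
        (∀ b i j, DifferentiableOn ℂ (fun z => Ũ z b i j) (ball 0 R)) ∧
        (∀ z ∈ ball (0 : VecField (F.P Kt) k (EuclideanSpace ℂ (Fin 3)) × VecField (F.P Kt) k (EuclideanSpace ℂ (Fin 3))) R, ∀ b i j, ‖Ũ z b i j‖ ≤ 𝓐₀) ∧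
        ∀ p B' : VecField (F.P Kt) k E3, ‖p‖ < R → ‖B'‖ < R → ∃ U' : GaugeField (F.P Kt) 0 SU2,
          (∀ b, Ũ (cplxVec p, cplxVec B') b = ((U' b : SU2) : Matrix (Fin 2) (Fin 2) ℂ)) ∧
            IsMinimizer (Node00.avOfRecord F 2 Kt) (Node00.regMSCoPOfRecord F 2 {ν with εreg := εr} Kt k (maxDomT ν.M₁ Z)) (Bj ν.M₁ Z k)
              (avgFamily (Node00.avOfRecord F 2 Kt) (qsstarGIter0 k (expMul su2Chart B' (ext (expMul su2Chart p Vk))))) U' := by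
  obtain ⟨δ₀, hδ₀, h⟩ := hMin_closedGuard_atRecord_Bj_of_printLetters_ofClassThresholdUniform ν Kt hd3 Z hkK hk1 hdiv hfloor hZblk hsbU hρ hHB hB0
  refine ⟨δ₀, hδ₀, ?_⟩
  intro Λ lo hi eR heR n hn hN3 hlohi hbox hZ cE hcE hδρ ext hext 𝓐₀ h𝓐₀ εr hεr hερ hεH hα3 hα2 δc hδc0 hδcδ hletters
  have hcE0 : 0 ≤ cE := le_trans (by positivity) hcE
  have hδ : 0 < 2 * ((cE + 1) * eR) := by positivity
  obtain ⟨R, hR, h'⟩ := h (pts k Λ) lo hi hδ hδρ ext hext (plaqsInside (pts k (Z ∩ Λᶜ))) eR h𝓐₀ εr hεr hερ hεH hα3 hα2 hδc0 hδcδ fun Vk hVk => by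
      obtain ⟨U₀, hmin, hrowNF, hT1⟩ := hletters Vk hVk
      refine ⟨U₀, hmin, fun p hp => ?_, hrowNF, hT1⟩
      -- the closed guard `≤ eR` gives the strict guard `< 2eR`; the p. 193 extension is then `12d(n+2)²·2eR`-regular on `Z^{(k)}`
      have h2 : PlaqSmallOn (plaqsInside (pts k (Z ∩ Λᶜ))) (2 * eR) Vk := fun q hq => (hVk q hq).trans_lt (by linarith)
      have hreg := (dist1_plaqHol_extend_shellGauge_le (G := SU2) hd3 hlohi hn hN3 hbox hZ (by positivity) h2).1 p hp
      rw [hext]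
      refine hreg.trans_lt ?_
      have h1 : 12 * ((F.P Kt).d : ℝ) * ((n : ℝ) + 2) ^ 2 * (2 * eR) ≤ cE * (2 * eR) := mul_le_mul_of_nonneg_right hcE (by positivity)
      have h3 : cE * (2 * eR) + 2 * eR = 2 * ((cE + 1) * eR) := by ring
      linarith
  exact ⟨R, hR, fun Vk hVk => h' Vk (plaqLeOn_of_plaqSmallOn hVk)⟩


/-! ## §2  The same with (δ) asked of a RESIDUAL re-gauging `U₀^σ` — the road of record (dag-n12-w3's (σ)_N producer supplies `σ` and the (δ) row per base field) -/

/-- ★★★ **THE KNIT's (J0′) ROW SHAPE, εreg-UNIFORM, FROM (E) + (σ residual, (δ)@`δc` for `U₀^σ`) + (T1@q₀) PER BASE FIELD** — §1 over the residual-gauge twin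
`N12MinimiserFamilyAtRecordBjTowerThresholdUniform.hMin_closedGuard_atRecord_Bj_of_printLetters_ofClassThresholdUniform_residual`: per base field of the closed guard on `(Z ∩ Λᶜ)^{(k)}`
the consumer supplies the (2.12) minimiser `U₀` for the class at `εr`, a RESIDUAL gauge `σ` (scale-`j` images `1` at both ends of every constrained bond of `𝐁_k(Z)`), (δ)@`δc` for
`U₀^σ`, (T1@q₀) for `U₀`; the datum row discharged as in §1.  Conclusion: 12Q ∕ 12X-W v11's `hMin P i` ∀-body on the strict guard (class at `εr`).
[cite: Balaban1989LargeFieldI, (1.74) p.192, p.193 L14–20, Prop. 1 p.194; Balaban1985Variational, Thm 1 p.279, (3)–(4) p.278, (181) p.307, Prop. 9 (190) p.309; Balaban1985RegularSpaces, (1.7) p.77; Balaban1989LargeFieldII, p.357, (1.12)–(1.13) p.359; Balaban1988Convergent, (2.10)–(2.13) pp.256–257; Balaban1987RG1, (0.4) p.253] -/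
theorem exists_R_hMinRow_of_printLetters_ofClassThresholdUniform_residual (ν : Node00.Stage7Numerics) (Kt : ℕ) (hd3 : 3 ≤ (F.P Kt).d) (Z : Set (Site (F.P Kt) 0))
    (hkK : k + 1 ≤ (F.P Kt).m + (F.P Kt).K) (hk1 : 1 ≤ k) (hdiv : side (F.P Kt).L ν.M₁ k ∣ (F.P Kt).sitesPerDir 0) (hfloor : ((F.P Kt).d + 14) * (F.P Kt).L ≤ ν.M₁) (hZblk : IsBlockUnion k Z)
    -- the per-HEIGHT letters (EXISTENCE constants per (instance, height), inhabited before everything else by dag-n12-w6's `N12HsurjOfClass.exists_hsurjLetters`): the radius letter `hsbU` at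
    -- `ρ″ > 0` and the right-inverse letter `hHB` at `(εH, B)`, `0 ≤ B` — `ν.εreg` is NOT read (the class tolerance `εr` comes after the threshold)
    {ρ'' : ℝ} (hsbU : ∀ W : GaugeField (F.P Kt) 0 SU2, ‖coeField W - 1‖ ≤ ρ'' → SmallBelow (Node00.avOfRecord F 2 Kt) k W) (hρ : 0 < ρ'')
    {εH B : ℝ}
    (hHB : ∀ (Wd : MSField (F.P Kt) SU2) (U₀ : GaugeField (F.P Kt) 0 SU2),
      AgreeOn (Bj ν.M₁ Z k) (avgFamily (avOfRecord F 2 Kt) U₀) Wd →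
      (∀ i' : Fin (constrCard (Bj ν.M₁ Z k) k), ∃ U' : GaugeField (F.P Kt) 0 SU2,
        (∀ b ∈ feeds (((constrEnum (Bj ν.M₁ Z k) k).symm i').1 : ℕ) ((constrEnum (Bj ν.M₁ Z k) k).symm i').2.1, U' b = U₀ b) ∧
          SmallBelow (avOfRecord F 2 Kt) k U') →
      (∀ (j : ℕ), 1 ≤ j → j ≤ k → ∀ y : Site (F.P Kt) j, embIter j y ∈ maxDomT ν.M₁ Z j → ∃ U' : GaugeField (F.P Kt) 0 SU2,
        (∀ c : PBond (F.P Kt) j, (c.src = y ∨ c.tgt = y) → ∀ b₀ : PBond (F.P Kt) 0,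
          (iterBlockOf j b₀.src = c.src ∨ iterBlockOf j b₀.src = c.tgt) → (iterBlockOf j b₀.tgt = c.src ∨ iterBlockOf j b₀.tgt = c.tgt) → U' b₀ = U₀ b₀) ∧
        SmallBelow (avOfRecord F 2 Kt) k U') →
      (∀ (j : ℕ), 1 ≤ j → j ≤ k → ∀ y : Site (F.P Kt) j, embIter j y ∈ maxDomT ν.M₁ Z j →
        PlaqSmallOn (boxPlaqs (fun κ => lift (F.P Kt) (embIter j y) κ - ((((F.P Kt).L ^ j : ℕ) : ℤ) + ((((F.P Kt).L ^ j - 1) / 2 : ℕ) : ℤ)))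
          (fun κ => lift (F.P Kt) (embIter j y) κ + ((((F.P Kt).L ^ j : ℕ) : ℤ) + ((((F.P Kt).L ^ j - 1) / 2 : ℕ) : ℤ))) : Set (Plaq (F.P Kt) 0)) εH U₀) →
      ∃ H : (Fin (constrCard (Bj ν.M₁ Z k) k) → lieSU (Fin 2)) → PBond (F.P Kt) 0 → lieSU (Fin 2),
        (∀ v, fderiv ℝ (msChart F 2 Kt k (Bj ν.M₁ Z k) Wd U₀) 0 (H v) = v) ∧ ∀ v, Real.sqrt (∑ b, ‖H v b‖ ^ 2) ≤ B * ‖v‖) (hB0 : 0 ≤ B) :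
    ∃ δ₀ : ℝ, 0 < δ₀ ∧
    -- AFTER THE THRESHOLD: the knit's window `Λ lo hi`, the guard radius `eR > 0`, the knit's own GEOMETRY rows `hn hN3 hlohi hbox hZ` and extension constant `cE ≥ 12d(n+2)²` (12Q v11's
    -- `hcE`) — from which the datum's scale-`k` plaquette regularity on `Z` at `δ := 2(cE+1)·eR` follows (`dist1_plaqHol_extend_shellGauge_le`) — the budget `6(d−1)Lᵏ·δ ≤ ρ″`, the p. 193
    -- extension at `pts k Λ`, the bound `𝓐₀`
    ∀ (Λ : Set (Site (F.P Kt) 0)) (lo hi : Fin (F.P Kt).d → ℤ) (eR : ℝ), 0 < eR →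
    ∀ (n : ℕ), (∀ κ, hi κ ≤ lo κ + n) → (∀ κ, hi κ - lo κ + 3 < ((F.P Kt).sitesPerDir k : ℤ)) → lo ≤ hi →
      pts k Λ = (castSite '' Set.Icc lo hi : Set (Site (F.P Kt) k)) → (boxPlaqs (lo - 1) (hi + 1) : Set (Plaq (F.P Kt) k)) ⊆ plaqsInside (pts k Z) →
    ∀ {cE : ℝ}, 12 * ((F.P Kt).d : ℝ) * ((n : ℝ) + 2) ^ 2 ≤ cE → 6 * ((((F.P Kt).d - 1 : ℕ)) : ℝ) * (F.P Kt).L ^ k * (2 * ((cE + 1) * eR)) ≤ ρ'' →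
    ∀ (ext : GaugeField (F.P Kt) k SU2 → GaugeField (F.P Kt) k SU2), (∀ W, ext W = extend (pts k Λ) (shellGauge W lo hi) W) →
    ∀ {𝓐₀ : ℝ}, 1 < 𝓐₀ →
    -- (w1 g4's class letters at the tolerance `εr`: positivity and [4] Prop. 2's smallness at `α₀ = 2L²·εr` — the inputs of `classLetters_closure_regMSCoPOfRecord_Bj`, which discharges U2's
    -- class facts `reg' hreg' hcl hDreg'` at `reg' := closure` of the class `U_k({Ω_j(Z)}, εr)`)
    ∀ (εr : ℝ), 0 < εr → 12 * ((((F.P Kt).d - 1 : ℕ)) : ℝ) * (F.P Kt).L * εr ≤ ρ'' → εr ≤ εH →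
      (143 * (((((F.P Kt).d + 4 : ℕ) : ℝ)) ^ 2 / 4) ^ 2) * (2 * ((F.P Kt).L : ℝ) ^ 2 * εr) ≤ 1 / 3 →
      2 * (2 * ((F.P Kt).L : ℝ) ^ 2 * εr) ≤ 2 * deltaSU (Fin 2) / ((((F.P Kt).d + 4) * (F.P Kt).L : ℕ) : ℝ) ^ 2 →
    ∀ {δc : ℝ}, 0 ≤ δc → δc ≤ δ₀ →
    (∀ Vk : GaugeField (F.P Kt) k SU2, (∀ p ∈ plaqsInside (pts k (Z ∩ Λᶜ)), dist1 (GaugeField.plaqHol Vk p) ≤ eR) → ∃ (U₀ : GaugeField (F.P Kt) 0 SU2) (σ : GaugeTransf (F.P Kt) 0 SU2),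
      IsMinimizer (Node00.avOfRecord F 2 Kt) (Node00.regMSCoPOfRecord F 2 {ν with εreg := εr} Kt k (maxDomT ν.M₁ Z)) (Bj ν.M₁ Z k)
        (avgFamily (Node00.avOfRecord F 2 Kt) (qsstarGIter0 k (ext Vk))) U₀ ∧
      -- (NO datum plaquette-regularity row: discharged below from the closed guard on `Z ∩ Λᶜ` and the p. 193 extension)
      -- a RESIDUAL gauge `σ` (scale-`j` images `1` at both ends of every constrained bond — dag-n12-w3's (σ)_N producer's shape) …
      (∀ j, j ≤ k → ∀ b ∈ bondsOf (Bj ν.M₁ Z k j), toMS σ j b.src = 1 ∧ toMS σ j b.tgt = 1) ∧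
      -- … in which (δ) holds: `U₀^σ` bondwise `δc`-flat on the plaquettes meeting a bond sourced in `Ω₁(Z)`; the tower-flatness row (δ_T) and the multiplier row (M) of p717767 FOLLOW (`B15Prop1TowerFlatOfNearFlat`; dag-n12-w6's `…N12MultiplierLetterOfClass` + the lane's `…N12SliceDatumCurvatureOfClass`)
      (∀ q : Plaq (F.P Kt) 0, ((⟨q.src, q.μ⟩ : PBond (F.P Kt) 0) ∈ {b : PBond (F.P Kt) 0 | b.src ∈ maxDomT ν.M₁ Z 1} ∨
          (⟨q.src.shift q.μ, q.ν⟩ : PBond (F.P Kt) 0) ∈ {b : PBond (F.P Kt) 0 | b.src ∈ maxDomT ν.M₁ Z 1} ∨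
          (⟨q.src.shift q.ν, q.μ⟩ : PBond (F.P Kt) 0) ∈ {b : PBond (F.P Kt) 0 | b.src ∈ maxDomT ν.M₁ Z 1} ∨
          (⟨q.src, q.ν⟩ : PBond (F.P Kt) 0) ∈ {b : PBond (F.P Kt) 0 | b.src ∈ maxDomT ν.M₁ Z 1}) →
        ‖((gaugeAct σ U₀ ⟨q.src, q.μ⟩ : SU2) : Matrix (Fin 2) (Fin 2) ℂ) - 1‖ ≤ δc ∧ ‖((gaugeAct σ U₀ ⟨q.src.shift q.μ, q.ν⟩ : SU2) : Matrix (Fin 2) (Fin 2) ℂ) - 1‖ ≤ δc ∧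
          ‖((gaugeAct σ U₀ ⟨q.src.shift q.ν, q.μ⟩ : SU2) : Matrix (Fin 2) (Fin 2) ℂ) - 1‖ ≤ δc ∧ ‖((gaugeAct σ U₀ ⟨q.src, q.ν⟩ : SU2) : Matrix (Fin 2) (Fin 2) ℂ) - 1‖ ≤ δc) ∧
      -- (T1@q₀) — the capstone's row verbatim
      (∀ U ∈ closure (Node00.regMSCoPOfRecord F 2 {ν with εreg := εr} Kt k (maxDomT ν.M₁ Z)),
        AgreeOn (Bj ν.M₁ Z k) (avgFamily (Node00.avOfRecord F 2 Kt) U) (avgFamily (Node00.avOfRecord F 2 Kt) (qsstarGIter0 k (ext Vk))) →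
        wilsonAction4 U ≤ wilsonAction4 U₀ →
          ∃ u : GaugeTransf (F.P Kt) 0 SU2, (∀ j, j ≤ k → ∀ b ∈ bondsOf (Bj ν.M₁ Z k j), toMS u j b.src = toMS u j b.tgt ∧ ∀ g : SU2, toMS u j b.src * g = g * toMS u j b.src) ∧ gaugeAct u U = U₀)) →
    ∃ R : ℝ, 0 < R ∧ ∀ Vk : GaugeField (F.P Kt) k SU2, PlaqSmallOn (plaqsInside (pts k (Z ∩ Λᶜ))) eR Vk →
      ∃ Ũ : VecField (F.P Kt) k (EuclideanSpace ℂ (Fin 3)) × VecField (F.P Kt) k (EuclideanSpace ℂ (Fin 3)) → PBond (F.P Kt) 0 → Matrix (Fin 2) (Fin 2) ℂ,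
        (∀ b i j, DifferentiableOn ℂ (fun z => Ũ z b i j) (ball 0 R)) ∧
        (∀ z ∈ ball (0 : VecField (F.P Kt) k (EuclideanSpace ℂ (Fin 3)) × VecField (F.P Kt) k (EuclideanSpace ℂ (Fin 3))) R, ∀ b i j, ‖Ũ z b i j‖ ≤ 𝓐₀) ∧
        ∀ p B' : VecField (F.P Kt) k E3, ‖p‖ < R → ‖B'‖ < R → ∃ U' : GaugeField (F.P Kt) 0 SU2,
          (∀ b, Ũ (cplxVec p, cplxVec B') b = ((U' b : SU2) : Matrix (Fin 2) (Fin 2) ℂ)) ∧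
            IsMinimizer (Node00.avOfRecord F 2 Kt) (Node00.regMSCoPOfRecord F 2 {ν with εreg := εr} Kt k (maxDomT ν.M₁ Z)) (Bj ν.M₁ Z k)
              (avgFamily (Node00.avOfRecord F 2 Kt) (qsstarGIter0 k (expMul su2Chart B' (ext (expMul su2Chart p Vk))))) U' := by
  obtain ⟨δ₀, hδ₀, h⟩ := hMin_closedGuard_atRecord_Bj_of_printLetters_ofClassThresholdUniform_residual ν Kt hd3 Z hkK hk1 hdiv hfloor hZblk hsbU hρ hHB hB0
  refine ⟨δ₀, hδ₀, ?_⟩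
  intro Λ lo hi eR heR n hn hN3 hlohi hbox hZ cE hcE hδρ ext hext 𝓐₀ h𝓐₀ εr hεr hερ hεH hα3 hα2 δc hδc0 hδcδ hletters
  have hcE0 : 0 ≤ cE := le_trans (by positivity) hcE
  have hδ : 0 < 2 * ((cE + 1) * eR) := by positivity
  obtain ⟨R, hR, h'⟩ := h (pts k Λ) lo hi hδ hδρ ext hext (plaqsInside (pts k (Z ∩ Λᶜ))) eR h𝓐₀ εr hεr hερ hεH hα3 hα2 hδc0 hδcδ fun Vk hVk => by
      obtain ⟨U₀, σ, hmin, hσ, hrowNF, hT1⟩ := hletters Vk hVk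
      refine ⟨U₀, σ, hmin, fun p hp => ?_, hσ, hrowNF, hT1⟩
      -- the closed guard `≤ eR` gives the strict guard `< 2eR`; the p. 193 extension is then `12d(n+2)²·2eR`-regular on `Z^{(k)}`
      have h2 : PlaqSmallOn (plaqsInside (pts k (Z ∩ Λᶜ))) (2 * eR) Vk := fun q hq => (hVk q hq).trans_lt (by linarith)
      have hreg := (dist1_plaqHol_extend_shellGauge_le (G := SU2) hd3 hlohi hn hN3 hbox hZ (by positivity) h2).1 p hp
      rw [hext]
      refine hreg.trans_lt ?_
      have h1 : 12 * ((F.P Kt).d : ℝ) * ((n : ℝ) + 2) ^ 2 * (2 * eR) ≤ cE * (2 * eR) := mul_le_mul_of_nonneg_right hcE (by positivity)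
      have h3 : cE * (2 * eR) + 2 * eR = 2 * ((cE + 1) * eR) := by ring
      linarith
  exact ⟨R, hR, fun Vk hVk => h' Vk (plaqLeOn_of_plaqSmallOn hVk)⟩


/-! ## §3  The same with the gauge row GONE — over the datum-letters twin (U3): per base field (E) + the datum's bondwise flatness on `𝒞` + (T1@q₀), NO row on the unknown minimiser
except [15] Thm 1's -/

/-- ★★★ **THE KNIT's (J0′) ROW SHAPE, εreg-UNIFORM, FROM (E) + ONE DATUM LETTER + (T1@q₀) PER BASE FIELD** — §1 over the datum-letters twin
`N12MinimiserFamilyAtRecordBjTowerDatumLettersUniform.hMin_closedGuard_atRecord_Bj_of_printLetters_ofClassDatumLettersUniform` (over the lane's U3 = U2 §3 ∘ dag-n12-w3's (σ)_N letter of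
record): instance-level, besides §1's letters, the (σ)_N level guard ∕ no-wrap ∕ radii ∕ support numerics (`hkc hc hMrad hM₁`), the region ∕ shadow geometry (`𝒞 N hGN hN1 hGmem`) VERBATIM
from U3; announced `∃ δ₀ > 0`; then for every window + geometry rows, guard radius `eR > 0` with its budget, extension, `𝓐₀`, class tolerance `εr > 0` (floors, `hα3 hα2`), datum bond
tolerance `ρn ≥ 0` with U3's «`T(ρn, εr) ≤ δ₀`», per base field of the closed guard on `(Z ∩ Λᶜ)^{(k)}` the consumer supplies ONLY: (E) the (2.12) minimiser `U₀` for `U_k({Ω_j(Z)}, εr)`,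
the datum letter `∀ c ∈ 𝒞, dist1 ((ext V_k) c) ≤ ρn` (a condition on the BASE FIELD's `k`-shadow; LOCATED-GEOM v3 scope), (T1@q₀) over the closure of the class — the datum's plaquette
regularity on `Z` discharged as in §1 at `δ := 2(cE+1)eR`.  Conclusion: 12Q ∕ 12X-W v11's `hMin P i` ∀-body on the strict guard (class at `εr`).
[cite: Balaban1989LargeFieldI, (1.74) p.192, p.193 L14–20, Prop. 1 p.194; Balaban1985Variational, (2)–(4),(7) p.278, Thm 1 p.279, (16)–(18) p.280, (181) p.307, Prop. 9 (190) p.309; Balaban1985RegularSpaces, (1.7), (1.9) p.77, (1.19) p.79; Balaban1989LargeFieldII, p.357, (1.12)–(1.13) p.359; Balaban1988Convergent, (2.10)–(2.13) pp.256–257, (2.16) p.257; Balaban1985Averaging, Prop. 2 (52)–(54) p.26; Balaban1987RG1, (0.4) p.253] -/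
theorem exists_R_hMinRow_of_printLetters_ofClassDatumLettersUniform (ν : Node00.Stage7Numerics) (Kt : ℕ) (hd3 : 3 ≤ (F.P Kt).d) (Z : Set (Site (F.P Kt) 0))
    (hkK : k + 1 ≤ (F.P Kt).m + (F.P Kt).K) (hk1 : 1 ≤ k) (hdiv : side (F.P Kt).L ν.M₁ k ∣ (F.P Kt).sitesPerDir 0) (hfloor : ((F.P Kt).d + 14) * (F.P Kt).L ≤ ν.M₁) (hZblk : IsBlockUnion k Z)
    -- the per-HEIGHT letters (EXISTENCE constants per (instance, height), inhabited before everything else by dag-n12-w6's `N12HsurjOfClass.exists_hsurjLetters`): the radius letter `hsbU` at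
    -- `ρ″ > 0` and the right-inverse letter `hHB` at `(εH, B)`, `0 ≤ B` — `ν.εreg` is NOT read (the class tolerance `εr` comes after the threshold)
    {ρ'' : ℝ} (hsbU : ∀ W : GaugeField (F.P Kt) 0 SU2, ‖coeField W - 1‖ ≤ ρ'' → SmallBelow (Node00.avOfRecord F 2 Kt) k W) (hρ : 0 < ρ'')
    {εH B : ℝ}
    (hHB : ∀ (Wd : MSField (F.P Kt) SU2) (U₀ : GaugeField (F.P Kt) 0 SU2),
      AgreeOn (Bj ν.M₁ Z k) (avgFamily (avOfRecord F 2 Kt) U₀) Wd →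
      (∀ i' : Fin (constrCard (Bj ν.M₁ Z k) k), ∃ U' : GaugeField (F.P Kt) 0 SU2,
        (∀ b ∈ feeds (((constrEnum (Bj ν.M₁ Z k) k).symm i').1 : ℕ) ((constrEnum (Bj ν.M₁ Z k) k).symm i').2.1, U' b = U₀ b) ∧
          SmallBelow (avOfRecord F 2 Kt) k U') →
      (∀ (j : ℕ), 1 ≤ j → j ≤ k → ∀ y : Site (F.P Kt) j, embIter j y ∈ maxDomT ν.M₁ Z j → ∃ U' : GaugeField (F.P Kt) 0 SU2,
        (∀ c : PBond (F.P Kt) j, (c.src = y ∨ c.tgt = y) → ∀ b₀ : PBond (F.P Kt) 0,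
          (iterBlockOf j b₀.src = c.src ∨ iterBlockOf j b₀.src = c.tgt) → (iterBlockOf j b₀.tgt = c.src ∨ iterBlockOf j b₀.tgt = c.tgt) → U' b₀ = U₀ b₀) ∧
        SmallBelow (avOfRecord F 2 Kt) k U') →
      (∀ (j : ℕ), 1 ≤ j → j ≤ k → ∀ y : Site (F.P Kt) j, embIter j y ∈ maxDomT ν.M₁ Z j →
        PlaqSmallOn (boxPlaqs (fun κ => lift (F.P Kt) (embIter j y) κ - ((((F.P Kt).L ^ j : ℕ) : ℤ) + ((((F.P Kt).L ^ j - 1) / 2 : ℕ) : ℤ)))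
          (fun κ => lift (F.P Kt) (embIter j y) κ + ((((F.P Kt).L ^ j : ℕ) : ℤ) + ((((F.P Kt).L ^ j - 1) / 2 : ℕ) : ℤ))) : Set (Plaq (F.P Kt) 0)) εH U₀) →
      ∃ H : (Fin (constrCard (Bj ν.M₁ Z k) k) → lieSU (Fin 2)) → PBond (F.P Kt) 0 → lieSU (Fin 2),
        (∀ v, fderiv ℝ (msChart F 2 Kt k (Bj ν.M₁ Z k) Wd U₀) 0 (H v) = v) ∧ ∀ v, Real.sqrt (∑ b, ‖H v b‖ ^ 2) ≤ B * ‖v‖) (hB0 : 0 ≤ B)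
    -- (σ)_N OF RECORD (dag-n12-w3's `N12GaugeLetterLocExplicit.exists_gaugeLetterLoc_atRecord_explicit`), instance-level letters VERBATIM:
    -- NUMERICS (i): a level guard `k + c ≤ m + K` with `4d + m′ + 3 < 2·L^c` (no wrapping), and `M₁ ≥ (4d + m′)·L² + 2d·L + 12` (radii), `m′ = 3·(d·((L−1)∕2)) + 5`
    {c : ℕ} (hkc : k + c ≤ (F.P Kt).m + (F.P Kt).K) (hc : 4 * (F.P Kt).d + (3 * ((F.P Kt).d * (((F.P Kt).L - 1) / 2)) + 5) + 3 < 2 * (F.P Kt).L ^ c)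
    (hMrad : (4 * (F.P Kt).d + (3 * ((F.P Kt).d * (((F.P Kt).L - 1) / 2)) + 5)) * (F.P Kt).L ^ 2 + 2 * (F.P Kt).d * (F.P Kt).L + 12 ≤ ν.M₁)
    -- region geometry (dag-n12-w6's letters, verbatim) for a set `𝒞` of scale-`k` bonds and a fine bond set `N`
    (𝒞 : Set (PBond (F.P Kt) k))
    (N : Set (PBond (F.P Kt) 0))
    (hGN : ∀ b ∈ N, (b.src ∉ maxDomT ν.M₁ Z 1 ∨ b.tgt ∉ maxDomT ν.M₁ Z 1) → B14.Eq22Determines.blockIter k b.tgt ≠ B14.Eq22Determines.blockIter k b.src →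
      (⟨B14.Eq22Determines.blockIter k b.src, b.dir⟩ : PBond (F.P Kt) k) ∈ 𝒞)
    (hN1 : ∀ p : Plaq (F.P Kt) 0, ((⟨p.src, p.μ⟩ : PBond (F.P Kt) 0) ∈ {b : PBond (F.P Kt) 0 | b.src ∈ maxDomT ν.M₁ Z 1} ∨
        (⟨p.src.shift p.μ, p.ν⟩ : PBond (F.P Kt) 0) ∈ {b : PBond (F.P Kt) 0 | b.src ∈ maxDomT ν.M₁ Z 1} ∨
        (⟨p.src.shift p.ν, p.μ⟩ : PBond (F.P Kt) 0) ∈ {b : PBond (F.P Kt) 0 | b.src ∈ maxDomT ν.M₁ Z 1} ∨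
        (⟨p.src, p.ν⟩ : PBond (F.P Kt) 0) ∈ {b : PBond (F.P Kt) 0 | b.src ∈ maxDomT ν.M₁ Z 1}) →
      (⟨p.src, p.μ⟩ : PBond (F.P Kt) 0) ∈ N ∧ (⟨p.src.shift p.μ, p.ν⟩ : PBond (F.P Kt) 0) ∈ N ∧
        (⟨p.src.shift p.ν, p.μ⟩ : PBond (F.P Kt) 0) ∈ N ∧ (⟨p.src, p.ν⟩ : PBond (F.P Kt) 0) ∈ N)
    -- the family's support numerics: `M₁ ≥ ((d+4)L + 6)·L²`
    (hM₁ : (((F.P Kt).d + 4) * (F.P Kt).L + 6) * (F.P Kt).L ^ 2 ≤ ν.M₁)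
    -- GEOMETRY instead of the datum letter: the `k`-shadows of the face-crossing members of `𝐁_k(Z)` lie in `𝒞`
    (hGmem : ∀ i ≤ k, ∀ c ∈ bondsOf ((Bj ν.M₁ Z k : DetSet (F.P Kt)) i), B14.Eq22Determines.blockIter k (embIter i c.tgt) ≠ B14.Eq22Determines.blockIter k (embIter i c.src) →
      (⟨B14.Eq22Determines.blockIter k (embIter i c.src), c.dir⟩ : PBond (F.P Kt) k) ∈ 𝒞) :
    ∃ δ₀ : ℝ, 0 < δ₀ ∧
    -- AFTER THE THRESHOLD: the knit's window `Λ lo hi`, the guard radius `eR > 0`, the knit's own GEOMETRY rows `hn hN3 hlohi hbox hZ` and extension constant `cE ≥ 12d(n+2)²` (12Q v11's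
    -- `hcE`) — from which the datum's scale-`k` plaquette regularity on `Z` at `δ := 2(cE+1)·eR` follows (`dist1_plaqHol_extend_shellGauge_le`) — the budget `6(d−1)Lᵏ·δ ≤ ρ″`, the p. 193
    -- extension at `pts k Λ`, the bound `𝓐₀`
    ∀ (Λ : Set (Site (F.P Kt) 0)) (lo hi : Fin (F.P Kt).d → ℤ) (eR : ℝ), 0 < eR →
    ∀ (n : ℕ), (∀ κ, hi κ ≤ lo κ + n) → (∀ κ, hi κ - lo κ + 3 < ((F.P Kt).sitesPerDir k : ℤ)) → lo ≤ hi →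
      pts k Λ = (castSite '' Set.Icc lo hi : Set (Site (F.P Kt) k)) → (boxPlaqs (lo - 1) (hi + 1) : Set (Plaq (F.P Kt) k)) ⊆ plaqsInside (pts k Z) →
    ∀ {cE : ℝ}, 12 * ((F.P Kt).d : ℝ) * ((n : ℝ) + 2) ^ 2 ≤ cE → 6 * ((((F.P Kt).d - 1 : ℕ)) : ℝ) * (F.P Kt).L ^ k * (2 * ((cE + 1) * eR)) ≤ ρ'' →
    ∀ (ext : GaugeField (F.P Kt) k SU2 → GaugeField (F.P Kt) k SU2), (∀ W, ext W = extend (pts k Λ) (shellGauge W lo hi) W) →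
    ∀ {𝓐₀ : ℝ}, 1 < 𝓐₀ →
    -- (w1 g4's class letters at the tolerance `εr`: positivity and [4] Prop. 2's smallness at `α₀ = 2L²·εr` — the inputs of `classLetters_closure_regMSCoPOfRecord_Bj`, which discharges U3's
    -- class facts `reg' hreg' hcl hDreg'` at `reg' := closure` of `U_k({Ω_j(Z)}, εr)`; U3's own (σ)_N class numerics `hα3`∕`hα2`∕`haN` at `α₀ = εr·L²` follow from them and are discharged)
    ∀ (εr : ℝ), 0 < εr → 12 * ((((F.P Kt).d - 1 : ℕ)) : ℝ) * (F.P Kt).L * εr ≤ ρ'' → εr ≤ εH →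
      (143 * (((((F.P Kt).d + 4 : ℕ) : ℝ)) ^ 2 / 4) ^ 2) * (2 * ((F.P Kt).L : ℝ) ^ 2 * εr) ≤ 1 / 3 →
      2 * (2 * ((F.P Kt).L : ℝ) ^ 2 * εr) ≤ 2 * deltaSU (Fin 2) / ((((F.P Kt).d + 4) * (F.P Kt).L : ℕ) : ℝ) ^ 2 →
    ∀ {ρn : ℝ}, 0 ≤ ρn →
    ((max ρn ((((2 * (∑ i ∈ Finset.range (k + 1), ((F.P Kt).d * (((F.P Kt).L ^ i - 1) / 2) + 1)) + 1 +
                  (3 * ((F.P Kt).d * (((F.P Kt).L - 1) / 2)) + 5) * (F.P Kt).L ^ k : ℕ) : ℝ)) ^ 2 / 4 * (εr * (F.P Kt).eta 0 ^ 2) +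
                ((3 * ((F.P Kt).d * (((F.P Kt).L - 1) / 2)) + 5 : ℕ) : ℝ) * (6 * ((((((F.P Kt).d + 2) * (F.P Kt).L : ℕ) : ℝ) ^ 2 / 4) * (2 * (εr * (F.P Kt).L ^ 2))) * ∑ i ∈ Finset.range k, ((F.P Kt).L : ℝ) ^ i) + ((3 * ((F.P Kt).d * (((F.P Kt).L - 1) / 2)) + 5 : ℕ) : ℝ) * ρn) ≤ δ₀) →
    (∀ Vk : GaugeField (F.P Kt) k SU2, (∀ p ∈ plaqsInside (pts k (Z ∩ Λᶜ)), dist1 (GaugeField.plaqHol Vk p) ≤ eR) → ∃ U₀ : GaugeField (F.P Kt) 0 SU2,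
      IsMinimizer (Node00.avOfRecord F 2 Kt) (Node00.regMSCoPOfRecord F 2 {ν with εreg := εr} Kt k (maxDomT ν.M₁ Z)) (Bj ν.M₁ Z k)
        (avgFamily (Node00.avOfRecord F 2 Kt) (qsstarGIter0 k (ext Vk))) U₀ ∧
      -- (NO datum plaquette-regularity row: discharged below from the closed guard on `Z ∩ Λᶜ` and the p. 193 extension)
      -- THE DATUM LETTER (region-normalised datum): `ext V_k` is `ρn`-flat on `𝒞`
      (∀ c ∈ 𝒞, dist1 ((ext Vk) c) ≤ ρn) ∧
      -- (T1@q₀) — the capstone's row verbatim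
      (∀ U ∈ closure (Node00.regMSCoPOfRecord F 2 {ν with εreg := εr} Kt k (maxDomT ν.M₁ Z)),
        AgreeOn (Bj ν.M₁ Z k) (avgFamily (Node00.avOfRecord F 2 Kt) U) (avgFamily (Node00.avOfRecord F 2 Kt) (qsstarGIter0 k (ext Vk))) →
        wilsonAction4 U ≤ wilsonAction4 U₀ →
          ∃ u : GaugeTransf (F.P Kt) 0 SU2, (∀ j, j ≤ k → ∀ b ∈ bondsOf (Bj ν.M₁ Z k j), toMS u j b.src = toMS u j b.tgt ∧ ∀ g : SU2, toMS u j b.src * g = g * toMS u j b.src) ∧ gaugeAct u U = U₀)) →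
    ∃ R : ℝ, 0 < R ∧ ∀ Vk : GaugeField (F.P Kt) k SU2, PlaqSmallOn (plaqsInside (pts k (Z ∩ Λᶜ))) eR Vk →
      ∃ Ũ : VecField (F.P Kt) k (EuclideanSpace ℂ (Fin 3)) × VecField (F.P Kt) k (EuclideanSpace ℂ (Fin 3)) → PBond (F.P Kt) 0 → Matrix (Fin 2) (Fin 2) ℂ,
        (∀ b i j, DifferentiableOn ℂ (fun z => Ũ z b i j) (ball 0 R)) ∧
        (∀ z ∈ ball (0 : VecField (F.P Kt) k (EuclideanSpace ℂ (Fin 3)) × VecField (F.P Kt) k (EuclideanSpace ℂ (Fin 3))) R, ∀ b i j, ‖Ũ z b i j‖ ≤ 𝓐₀) ∧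
        ∀ p B' : VecField (F.P Kt) k E3, ‖p‖ < R → ‖B'‖ < R → ∃ U' : GaugeField (F.P Kt) 0 SU2,
          (∀ b, Ũ (cplxVec p, cplxVec B') b = ((U' b : SU2) : Matrix (Fin 2) (Fin 2) ℂ)) ∧
            IsMinimizer (Node00.avOfRecord F 2 Kt) (Node00.regMSCoPOfRecord F 2 {ν with εreg := εr} Kt k (maxDomT ν.M₁ Z)) (Bj ν.M₁ Z k)
              (avgFamily (Node00.avOfRecord F 2 Kt) (qsstarGIter0 k (expMul su2Chart B' (ext (expMul su2Chart p Vk))))) U') := by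
  obtain ⟨δ₀, hδ₀, h⟩ := hMin_closedGuard_atRecord_Bj_of_printLetters_ofClassDatumLettersUniform ν Kt hd3 Z hkK hk1 hdiv hfloor hZblk hsbU hρ hHB hB0 hkc hc hMrad 𝒞 N hGN hN1 hM₁ hGmem
  refine ⟨δ₀, hδ₀, ?_⟩
  intro Λ lo hi eR heR n hn hN3 hlohi hbox hZ cE hcE hδρ ext hext 𝓐₀ h𝓐₀ εr hεr hερ hεH hα3 hα2 ρn hρn hT hletters
  have hcE0 : 0 ≤ cE := le_trans (by positivity) hcE
  have hδ : 0 < 2 * ((cE + 1) * eR) := by positivity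
  obtain ⟨R, hR, h'⟩ := h (pts k Λ) lo hi hδ hδρ ext hext (plaqsInside (pts k (Z ∩ Λᶜ))) eR h𝓐₀ εr hεr hερ hεH hα3 hα2 hρn hT fun Vk hVk => by
      obtain ⟨U₀, hmin, hD, hT1⟩ := hletters Vk hVk
      refine ⟨U₀, hmin, fun p hp => ?_, hD, hT1⟩
      -- the closed guard `≤ eR` gives the strict guard `< 2eR`; the p. 193 extension is then `12d(n+2)²·2eR`-regular on `Z^{(k)}`
      have h2 : PlaqSmallOn (plaqsInside (pts k (Z ∩ Λᶜ))) (2 * eR) Vk := fun q hq => (hVk q hq).trans_lt (by linarith)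
      have hreg := (dist1_plaqHol_extend_shellGauge_le (G := SU2) hd3 hlohi hn hN3 hbox hZ (by positivity) h2).1 p hp
      rw [hext]
      refine hreg.trans_lt ?_
      have h1 : 12 * ((F.P Kt).d : ℝ) * ((n : ℝ) + 2) ^ 2 * (2 * eR) ≤ cE * (2 * eR) := mul_le_mul_of_nonneg_right hcE (by positivity)
      have h3 : cE * (2 * eR) + 2 * eR = 2 * ((cE + 1) * eR) := by ring
      linarith
  exact ⟨R, hR, fun Vk hVk => h' Vk (plaqLeOn_of_plaqSmallOn hVk)⟩

end Summit.QuantumFields.YangMills.BalabanUVNodes.N12MinimiserFamilyKnitRowThresholdUniform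

end
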